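import Literature.NumberTheory.GelbartRogawski1991.UnitaryDualPairThetaLiftCharacterCovariance
import Literature.NumberTheory.GelbartRogawski1991.CompatibleSplittingCM
import HarnessLib

-- As in the lineage (`UnitaryDualPairThetaKernelGaussian`, `…ThetaLiftGaussianCMLine`, `…ThetaLiftGaussianCharacter`;
-- ops-buildfix G11b-3): statements over the theta-kernel datum elaborate to very large types; elaborate sequentially.
set_option Elab.async false

/-!
# Automorphic characters with non-zero theta lifts — UNCONDITIONALLY (`hGR` discharged by `gru_shape`)

Topic `NumberTheory/GelbartRogawski1991`; namespace `Literature.NumberTheory.GelbartRogawski1991.UnitaryDualPair`.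
KERNEL file: THEOREMS ONLY (no definition, no instance, no named fact, no `sorry`).

Every statement of `UnitaryDualPairThetaLiftGaussianCharacter` (automorphic characters of the CM line with non-zero
theta lift; invariant measures on `[U(diag d_W)]` with non-zero theta lift of the Gaussian) and of
`UnitaryDualPairThetaLiftCharacterCovariance` §2 (the opposite theta correspondence from `[U(diag d_V)]` to the CM line
is non-zero) carries a binder `hGR : (cmSplittingDatum …).CompatibleSplitting` — [GelbartRogawski1991, Prop. 3.1.1] at
the CM datum.  That proposition is a THEOREM of the tree for every CM dual-pair datum:
`GRConstruction.gru_shape` / `GRConstruction.compatibleSplitting_cmSplittingDatum` (`CompatibleSplittingCM`).  This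
file records the resulting UNCONDITIONAL statements — the datum's splitting being
`GRConstruction.compatibleSplitting_cmSplittingDatum L e dV hdV hdV0 dW hdW hdW0` — by one-line specialisation of
the public, witness-parametric theorems of those files:

* `gru_line_exists_character_thetaLift_gaussSB_haar_ne_zero` — Picard-type `d_V` at `ι₁` over a compact `[U(diag d_V)]`,
  a real non-degenerate line `⟨d_W⟩`: some automorphic character `χ` of `[U(⟨d_W⟩)]` has `Θ_{Φ_G}(χ) ≠ 0` (Haar);
* `gru_signs_exists_smulInvariantMeasure_thetaLift_gaussSB_ne_zero` — `W` of any rank: an invariant finite Borel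
  measure charging open sets on `[U(diag d_W)]` whose Gaussian theta lift is non-zero;
* `gru_U1U1_exists_character_thetaLift_gaussSB_haar_ne_zero` — **for EVERY CM field `L`, with NO hypothesis at all:
  some automorphic character of `[U(⟨1⟩)]` has a non-zero theta lift to `[U(⟨1⟩)]`**;
* `gru_sexticPicard_exists_character_thetaLift_gaussSB_haar_ne_zero` — the sextic Picard datum `(U(H₇), U(⟨1⟩))` over
  `ℚ(ζ₇)`, binder `e` only;
* `gru_U1U1_exists_character_pair_integral_thetaLift_gaussSB_ne_zero` — for every CM field, a THETA-RELATED PAIR `(χ, ψ)`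
  of automorphic characters of `[U(⟨1⟩)]`: `∫ Θ_{Φ_G}(χ) · ψ dν ≠ 0` (the unconditional form of
  `UnitaryDualPairThetaCharacterPairs` §1, proved here directly from the previous item and Pontryagin–van Kampen);
* `gru_line_exists_thetaLiftT_gaussSB_ne_zero`, `gru_U1U1_exists_thetaLiftT_gaussSB_ne_zero` — the OPPOSITE theta
  correspondence `C([U(diag d_V)]) → C([U(⟨d_W⟩)])` (FGKP (12.38)) at the Gaussian level is non-zero, in particular for
  `U(⟨1⟩) × U(⟨1⟩)` over every CM field with no hypothesis.

## References
* S. Gelbart, J. Rogawski, *L-functions and Fourier–Jacobi coefficients for the unitary group U(3)*, Invent. Math. 105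
  (1991), §3.1 Prop. 3.1.1 p. 455 L1–2, §3.2 p. 457 [GelbartRogawski1991].
* P. Fleig, H. P. A. Gustafsson, A. Kleinschmidt, D. Persson, *Eisenstein Series and Automorphic Representations* (2018),
  §12.3 Definition 12.5 (12.37)–(12.38), printed p. 296 [FleigEtAl2018].
* A. Deitmar, S. Echterhoff, *Principles of Harmonic Analysis*, 2nd ed. (2014), Prop. 3.5.2 [DeitmarEchterhoff2014].

## Provenance
Lane `lit-hodgefound` (HOME `run/shared/lean/pub/lit-hodgefound/`), prover seat `lit-hodgefound-p05` generation 5, eighth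
row (TRIBUNAL-C v27 wording rule: «conditional on hGR» → «hGR discharged by `gru_shape` (p317690)»).
-/

set_option autoImplicit false

noncomputable section

open scoped Matrix ComplexConjugate ComplexOrder
open NumberField NumberField.mixedEmbedding IsDedekindDomain
open _root_.MeasureTheory
open Literature.NumberTheory.Automorphic
open Literature.AlgebraicGeometry.ShimuraVarieties (hermForm)
open Literature.RepresentationTheory.CompactGroups

namespace Literature.NumberTheory.GelbartRogawski1991

namespace UnitaryDualPair

open Literature.NumberTheory.Weil1964

variable (L : Type) [Field L] [NumberField L] [IsCMField L]

/-- `U(⟨d⟩)(𝔸_{L⁺}) ⊂ GL₁(𝔸_L)` is commutative (`1 × 1` matrices over a commutative ring). [folklore] -/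
private theorem adelic_line_mul_comm (d : Fin 1 → L)
    (a b : ↥(UnitaryGroup.adelic ↥(maximalRealSubfield L) L (IsCMField.complexConj L) 1 (Matrix.diagonal d))) :
    a * b = b * a := by
  apply Subtype.ext
  show (a : GL (Fin 1) (AdeleRing (𝓞 L) L)) * b = b * a
  ext i j
  simp [Units.val_mul, Matrix.mul_apply, Subsingleton.elim i 0, Subsingleton.elim j 0, mul_comm]

/-- The rational points `U(⟨d⟩)(L⁺)` form a NORMAL subgroup of the commutative group `U(⟨d⟩)(𝔸_{L⁺})`. [folklore] -/
private theorem normal_range_toAdelic_line (d : Fin 1 → L) :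
    (UnitaryGroup.toAdelic ↥(maximalRealSubfield L) L (IsCMField.complexConj L) 1 (Matrix.diagonal d)).range.Normal :=
  ⟨fun m hm g => by rwa [adelic_line_mul_comm L d g m, mul_inv_cancel_right]⟩

/-- `1̄ = 1` coordinatewise (the hermitian lines `⟨1⟩`). [folklore] -/
private theorem complexConj_one_vec {m : ℕ} :
    ∀ i : Fin m, IsCMField.complexConj L ((1 : Fin m → L) i) = (1 : Fin m → L) i :=
  fun _ => by rw [Pi.one_apply, map_one]

omit [NumberField L] [IsCMField L] in
/-- `1 ≠ 0` coordinatewise. [folklore] -/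
private theorem one_vec_ne_zero {m : ℕ} : ∀ i : Fin m, (1 : Fin m → L) i ≠ 0 := fun _ => by
  rw [Pi.one_apply]; exact one_ne_zero

omit [NumberField L] [IsCMField L] in
/-- `re τ(1) = 1 > 0` through every complex embedding. [folklore] -/
private theorem re_apply_one_vec_pos {m : ℕ} (τ : L →+* ℂ) (j : Fin m) : 0 < (τ ((1 : Fin m → L) j)).re := by
  rw [Pi.one_apply, map_one, Complex.one_re]
  exact one_pos

/-! ## §1. The CM line over a Picard-type `d_V`; `W` of any rank -/

section Line

variable {N n : ℕ} (e : Fin N × Fin 1 ≃ Fin n)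
variable (dV : Fin N → L) (hdV : ∀ i, IsCMField.complexConj L (dV i) = dV i) (hdV0 : ∀ i, dV i ≠ 0)
variable (dW : Fin 1 → L) (hdW : ∀ i, IsCMField.complexConj L (dW i) = dW i) (hdW0 : ∀ i, dW i ≠ 0)

/-- **UNCONDITIONALLY: an automorphic character of the CM line with non-zero theta lift.**  For every CM field `L`, every
real non-degenerate diagonal `d_V` of Picard type at `ι₁` (`h₁V`, `hV`) over a compact `[U(diag d_V)]` and every real
non-degenerate line `⟨d_W⟩`, some continuous unitary character `χ` of the compact abelian group `[U(⟨d_W⟩)]` has a theta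
lift `Θ_{Φ_G}(χ) ≠ 0` in `C([U(diag d_V)], ℂ)` (Haar measure) — `cmThetaKernelDatum_line_exists_character_thetaLift_gaussSB_haar_ne_zero_fun`
with [GelbartRogawski1991, Prop. 3.1.1] supplied by `GRConstruction.compatibleSplitting_cmSplittingDatum`.
[cite: GelbartRogawski1991, §3.1 Prop. 3.1.1 p. 455 L1–2; GelbartRogawski1991, §3.2 p. 457; FleigEtAl2018, §12.3
Definition 12.5 (12.37), p. 296; DeitmarEchterhoff2014, Prop. 3.5.2] -/
theorem gru_line_exists_character_thetaLift_gaussSB_haar_ne_zero (ι₁ : L →+* ℂ)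
    (h₁V : ∃ i₀ : Fin N, (∀ i, i ≠ i₀ → 0 < (ι₁ (dV i)).re) ∨ ∀ i, i ≠ i₀ → (ι₁ (dV i)).re < 0)
    (hV : ∀ τ : L →+* ℂ, InfinitePlace.mk τ ≠ InfinitePlace.mk ι₁ →
      (∀ i, 0 < (τ (dV i)).re) ∨ ∀ i, (τ (dV i)).re < 0)
    [CompactSpace (↥(UnitaryGroup.adelic ↥(maximalRealSubfield L) L (IsCMField.complexConj L) N (Matrix.diagonal dV)) ⧸
      (UnitaryGroup.toAdelic ↥(maximalRealSubfield L) L (IsCMField.complexConj L) N (Matrix.diagonal dV)).range)] :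
    haveI := normal_range_toAdelic_line L dW
    letI : MeasurableSpace (↥(UnitaryGroup.adelic ↥(maximalRealSubfield L) L (IsCMField.complexConj L) 1 (Matrix.diagonal dW)) ⧸
      (UnitaryGroup.toAdelic ↥(maximalRealSubfield L) L (IsCMField.complexConj L) 1 (Matrix.diagonal dW)).range) := borel _
    haveI : BorelSpace (↥(UnitaryGroup.adelic ↥(maximalRealSubfield L) L (IsCMField.complexConj L) 1 (Matrix.diagonal dW)) ⧸
      (UnitaryGroup.toAdelic ↥(maximalRealSubfield L) L (IsCMField.complexConj L) 1 (Matrix.diagonal dW)).range) := ⟨rfl⟩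
    ∃ χ : PontryaginDual (↥(UnitaryGroup.adelic ↥(maximalRealSubfield L) L (IsCMField.complexConj L) 1 (Matrix.diagonal dW)) ⧸
      (UnitaryGroup.toAdelic ↥(maximalRealSubfield L) L (IsCMField.complexConj L) 1 (Matrix.diagonal dW)).range),
      (cmThetaKernelDatum L e dV hdV hdV0 dW hdW hdW0
          (GRConstruction.compatibleSplitting_cmSplittingDatum L e dV hdV hdV0 dW hdW hdW0)
          (hasThetaMajorants_cmPairSplitting_of_signs_one L e dV hdV hdV0 dW hdW hdW0 ι₁
            (GRConstruction.compatibleSplitting_cmSplittingDatum L e dV hdV hdV0 dW hdW hdW0) h₁V hV) Set.univ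
          (fun _ _ _ => Set.mem_univ _)).thetaLift Measure.haar (gaussSB ↥(maximalRealSubfield L) n) (charCM χ) ≠ 0 :=
  cmThetaKernelDatum_line_exists_character_thetaLift_gaussSB_haar_ne_zero_fun L e dV hdV hdV0 dW hdW hdW0 ι₁
    (GRConstruction.compatibleSplitting_cmSplittingDatum L e dV hdV hdV0 dW hdW hdW0) h₁V hV

/-- **UNCONDITIONALLY: the opposite theta correspondence from `[U(diag d_V)]` to the CM line is non-zero** —
`Θᵗ_{Φ_G}(F) ≠ 0` for some `F ∈ C([U(diag d_V)], ℂ)`, for every finite Borel measure `ν` on `[U(diag d_V)]` charging open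
sets (Picard-type `d_V` at `ι₁`, compact `[U(diag d_V)]`, real non-degenerate line `⟨d_W⟩`) —
`cmThetaKernelDatum_line_exists_thetaLiftT_gaussSB_ne_zero` with Prop. 3.1.1 supplied by
`GRConstruction.compatibleSplitting_cmSplittingDatum`. [cite: GelbartRogawski1991, §3.1 Prop. 3.1.1 p. 455 L1–2;
FleigEtAl2018, §12.3 Definition 12.5 (12.38), p. 296; DeitmarEchterhoff2014, Prop. 3.5.2] -/
theorem gru_line_exists_thetaLiftT_gaussSB_ne_zero (ι₁ : L →+* ℂ)
    (h₁V : ∃ i₀ : Fin N, (∀ i, i ≠ i₀ → 0 < (ι₁ (dV i)).re) ∨ ∀ i, i ≠ i₀ → (ι₁ (dV i)).re < 0)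
    (hV : ∀ τ : L →+* ℂ, InfinitePlace.mk τ ≠ InfinitePlace.mk ι₁ →
      (∀ i, 0 < (τ (dV i)).re) ∨ ∀ i, (τ (dV i)).re < 0)
    [CompactSpace (↥(UnitaryGroup.adelic ↥(maximalRealSubfield L) L (IsCMField.complexConj L) N (Matrix.diagonal dV)) ⧸
      (UnitaryGroup.toAdelic ↥(maximalRealSubfield L) L (IsCMField.complexConj L) N (Matrix.diagonal dV)).range)]
    [MeasurableSpace (↥(UnitaryGroup.adelic ↥(maximalRealSubfield L) L (IsCMField.complexConj L) N (Matrix.diagonal dV)) ⧸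
      (UnitaryGroup.toAdelic ↥(maximalRealSubfield L) L (IsCMField.complexConj L) N (Matrix.diagonal dV)).range)]
    [BorelSpace (↥(UnitaryGroup.adelic ↥(maximalRealSubfield L) L (IsCMField.complexConj L) N (Matrix.diagonal dV)) ⧸
      (UnitaryGroup.toAdelic ↥(maximalRealSubfield L) L (IsCMField.complexConj L) N (Matrix.diagonal dV)).range)]
    (ν : Measure (↥(UnitaryGroup.adelic ↥(maximalRealSubfield L) L (IsCMField.complexConj L) N (Matrix.diagonal dV)) ⧸
      (UnitaryGroup.toAdelic ↥(maximalRealSubfield L) L (IsCMField.complexConj L) N (Matrix.diagonal dV)).range))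
    [IsFiniteMeasure ν] [ν.IsOpenPosMeasure] :
    haveI := normal_range_toAdelic_line L dW
    haveI : CompactSpace (↥(UnitaryGroup.adelic ↥(maximalRealSubfield L) L (IsCMField.complexConj L) 1
        (Matrix.diagonal dW)) ⧸ (UnitaryGroup.toAdelic ↥(maximalRealSubfield L) L (IsCMField.complexConj L) 1
        (Matrix.diagonal dW)).range) := compactSpace_quotient_range_toAdelic_line L dW hdW hdW0
    ∃ F : C(↥(UnitaryGroup.adelic ↥(maximalRealSubfield L) L (IsCMField.complexConj L) N (Matrix.diagonal dV)) ⧸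
        (UnitaryGroup.toAdelic ↥(maximalRealSubfield L) L (IsCMField.complexConj L) N (Matrix.diagonal dV)).range, ℂ),
      (cmThetaKernelDatum L e dV hdV hdV0 dW hdW hdW0
          (GRConstruction.compatibleSplitting_cmSplittingDatum L e dV hdV hdV0 dW hdW hdW0)
          (hasThetaMajorants_cmPairSplitting_of_signs_one L e dV hdV hdV0 dW hdW hdW0 ι₁
            (GRConstruction.compatibleSplitting_cmSplittingDatum L e dV hdV hdV0 dW hdW hdW0) h₁V hV) Set.univ
          (fun _ _ _ => Set.mem_univ _)).thetaLiftT ν (gaussSB ↥(maximalRealSubfield L) n) F ≠ 0 :=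
  cmThetaKernelDatum_line_exists_thetaLiftT_gaussSB_ne_zero L e dV hdV hdV0 dW hdW hdW0
    (GRConstruction.compatibleSplitting_cmSplittingDatum L e dV hdV hdV0 dW hdW hdW0) ι₁ hV h₁V ν

end Line

section Signs

variable {N M n : ℕ} (e : Fin N × Fin M ≃ Fin n)
variable (dV : Fin N → L) (hdV : ∀ i, IsCMField.complexConj L (dV i) = dV i) (hdV0 : ∀ i, dV i ≠ 0)
variable (dW : Fin M → L) (hdW : ∀ i, IsCMField.complexConj L (dW i) = dW i) (hdW0 : ∀ i, dW i ≠ 0)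
variable (ι₁ : L →+* ℂ)
  (h₁V : ∃ i₀ : Fin N, (∀ i, i ≠ i₀ → 0 < (ι₁ (dV i)).re) ∨ ∀ i, i ≠ i₀ → (ι₁ (dV i)).re < 0)
  (h₁W : (∀ j, 0 < (ι₁ (dW j)).re) ∨ ∀ j, (ι₁ (dW j)).re < 0)
  (hV : ∀ τ : L →+* ℂ, InfinitePlace.mk τ ≠ InfinitePlace.mk ι₁ →
    (∀ i, 0 < (τ (dV i)).re) ∨ ∀ i, (τ (dV i)).re < 0)
  (hW : ∀ τ : L →+* ℂ, InfinitePlace.mk τ ≠ InfinitePlace.mk ι₁ →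
    (∃ j₀ : Fin M, ∀ j, j ≠ j₀ → 0 < (τ (dW j)).re) ∨ ∀ j, (τ (dW j)).re < 0)

/-- **UNCONDITIONALLY, `W` OF ANY RANK: an invariant finite Borel measure charging open sets on `[U(diag d_W)]` whose
theta lift of the Gaussian (against `conj θ_{Φ_G}(1̄, ·)`) is non-zero at `1̄ ∈ [U(diag d_V)]`** (sign data `h₁V`,
`h₁W`, `hV`, `hW` at and off the place of `ι₁`; compact `[U(diag d_V)]`) —
`cmThetaKernelDatum_signs_exists_smulInvariantMeasure_thetaLift_gaussSB_ne_zero` with Prop. 3.1.1 supplied by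
`GRConstruction.compatibleSplitting_cmSplittingDatum`. [cite: GelbartRogawski1991, §3.1 Prop. 3.1.1 p. 455 L1–2;
GelbartRogawski1991, §3.2 p. 457; FleigEtAl2018, §12.3 Definition 12.5 (12.37), p. 296; Borel1963, §5] -/
theorem gru_signs_exists_smulInvariantMeasure_thetaLift_gaussSB_ne_zero
    [CompactSpace (↥(UnitaryGroup.adelic ↥(maximalRealSubfield L) L (IsCMField.complexConj L) N (Matrix.diagonal dV)) ⧸
      (UnitaryGroup.toAdelic ↥(maximalRealSubfield L) L (IsCMField.complexConj L) N (Matrix.diagonal dV)).range)] :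
    letI : MeasurableSpace ↥(UnitaryGroup.adelic ↥(maximalRealSubfield L) L (IsCMField.complexConj L) M (Matrix.diagonal dW)) :=
      borel _
    ∃ ν : Measure (↥(UnitaryGroup.adelic ↥(maximalRealSubfield L) L (IsCMField.complexConj L) M (Matrix.diagonal dW)) ⧸
        (UnitaryGroup.toAdelic ↥(maximalRealSubfield L) L (IsCMField.complexConj L) M (Matrix.diagonal dW)).range),
      IsFiniteMeasure ν ∧ ν.IsOpenPosMeasure ∧
      SMulInvariantMeasure ↥(UnitaryGroup.adelic ↥(maximalRealSubfield L) L (IsCMField.complexConj L) M (Matrix.diagonal dW))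
        (↥(UnitaryGroup.adelic ↥(maximalRealSubfield L) L (IsCMField.complexConj L) M (Matrix.diagonal dW)) ⧸
          (UnitaryGroup.toAdelic ↥(maximalRealSubfield L) L (IsCMField.complexConj L) M (Matrix.diagonal dW)).range) ν ∧
      (cmThetaKernelDatum L e dV hdV hdV0 dW hdW hdW0
          (GRConstruction.compatibleSplitting_cmSplittingDatum L e dV hdV hdV0 dW hdW hdW0)
          (hasThetaMajorants_cmPairSplitting_of_signs L e dV hdV hdV0 dW hdW hdW0 ι₁
            (GRConstruction.compatibleSplitting_cmSplittingDatum L e dV hdV hdV0 dW hdW hdW0) h₁V h₁W hV hW) Set.univ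
          (fun _ _ _ => Set.mem_univ _)).thetaLift ν (gaussSB ↥(maximalRealSubfield L) n)
          (star ((cmThetaKernelDatum L e dV hdV hdV0 dW hdW hdW0
            (GRConstruction.compatibleSplitting_cmSplittingDatum L e dV hdV hdV0 dW hdW hdW0)
            (hasThetaMajorants_cmPairSplitting_of_signs L e dV hdV hdV0 dW hdW hdW0 ι₁
              (GRConstruction.compatibleSplitting_cmSplittingDatum L e dV hdV hdV0 dW hdW hdW0) h₁V h₁W hV hW) Set.univ
            (fun _ _ _ => Set.mem_univ _)).thetaKerSlice (gaussSB ↥(maximalRealSubfield L) n) (QuotientGroup.mk 1)))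
          (QuotientGroup.mk 1) ≠ 0 :=
  cmThetaKernelDatum_signs_exists_smulInvariantMeasure_thetaLift_gaussSB_ne_zero L e dV hdV hdV0 dW hdW hdW0 ι₁
    (GRConstruction.compatibleSplitting_cmSplittingDatum L e dV hdV hdV0 dW hdW hdW0) h₁V h₁W hV hW

end Signs

/-! ## §2. `U(⟨1⟩) × U(⟨1⟩)` over EVERY CM field — no hypothesis at all -/

section U1U1

/-- **FOR EVERY CM FIELD `L`, UNCONDITIONALLY: an automorphic character of `[U(⟨1⟩)]` with non-zero theta lift to
`[U(⟨1⟩)]`.**  For every re-indexing `e : Fin 1 × Fin 1 ≃ Fin 1` and every complex embedding `ι` (fixing the Gaussian's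
archimedean type) there is a continuous unitary character `χ` of the compact abelian group
`[U(⟨1⟩)] = U(⟨1⟩)(𝔸_{L⁺}) ⧸ U(⟨1⟩)(L⁺)` whose theta lift `Θ_{Φ_G}(χ)` (Haar measure) is a NON-ZERO element of
`C([U(⟨1⟩)], ℂ)` — [GelbartRogawski1991, Prop. 3.1.1] supplied by `GRConstruction.compatibleSplitting_cmSplittingDatum`,
the sign conditions automatic for `⟨1⟩`.  The first statement of the lineage's theta correspondence with NO binder but
the field. [cite: GelbartRogawski1991, §3.1 Prop. 3.1.1 p. 455 L1–2; GelbartRogawski1991, §3.2 p. 457; FleigEtAl2018,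
§12.3 Definition 12.5 (12.37), p. 296; DeitmarEchterhoff2014, Prop. 3.5.2] -/
theorem gru_U1U1_exists_character_thetaLift_gaussSB_haar_ne_zero (e : Fin 1 × Fin 1 ≃ Fin 1) (ι : L →+* ℂ) :
    haveI := normal_range_toAdelic_line L 1
    letI : MeasurableSpace (↥(UnitaryGroup.adelic ↥(maximalRealSubfield L) L (IsCMField.complexConj L) 1
        (Matrix.diagonal 1)) ⧸ (UnitaryGroup.toAdelic ↥(maximalRealSubfield L) L (IsCMField.complexConj L) 1
        (Matrix.diagonal 1)).range) := borel _
    haveI : BorelSpace (↥(UnitaryGroup.adelic ↥(maximalRealSubfield L) L (IsCMField.complexConj L) 1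
        (Matrix.diagonal 1)) ⧸ (UnitaryGroup.toAdelic ↥(maximalRealSubfield L) L (IsCMField.complexConj L) 1
        (Matrix.diagonal 1)).range) := ⟨rfl⟩
    haveI : CompactSpace (↥(UnitaryGroup.adelic ↥(maximalRealSubfield L) L (IsCMField.complexConj L) 1
        (Matrix.diagonal 1)) ⧸ (UnitaryGroup.toAdelic ↥(maximalRealSubfield L) L (IsCMField.complexConj L) 1
        (Matrix.diagonal 1)).range) := compactSpace_quotient_range_toAdelic_line L 1 (complexConj_one_vec L) (one_vec_ne_zero L)
    ∃ χ : PontryaginDual (↥(UnitaryGroup.adelic ↥(maximalRealSubfield L) L (IsCMField.complexConj L) 1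
        (Matrix.diagonal 1)) ⧸ (UnitaryGroup.toAdelic ↥(maximalRealSubfield L) L (IsCMField.complexConj L) 1
        (Matrix.diagonal 1)).range),
      (cmThetaKernelDatum L e 1 (complexConj_one_vec L) (one_vec_ne_zero L) 1 (complexConj_one_vec L) (one_vec_ne_zero L)
          (GRConstruction.compatibleSplitting_cmSplittingDatum L e 1 (complexConj_one_vec L) (one_vec_ne_zero L) 1
            (complexConj_one_vec L) (one_vec_ne_zero L))
          (hasThetaMajorants_cmPairSplitting_of_signs_one L e 1 (complexConj_one_vec L) (one_vec_ne_zero L) 1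
            (complexConj_one_vec L) (one_vec_ne_zero L) ι
            (GRConstruction.compatibleSplitting_cmSplittingDatum L e 1 (complexConj_one_vec L) (one_vec_ne_zero L) 1
              (complexConj_one_vec L) (one_vec_ne_zero L))
            ⟨0, Or.inl fun i hi => absurd (Subsingleton.elim i 0) hi⟩ (fun τ _ => Or.inl (re_apply_one_vec_pos L τ)))
          Set.univ (fun _ _ _ => Set.mem_univ _)).thetaLift Measure.haar (gaussSB ↥(maximalRealSubfield L) 1)
          (charCM χ) ≠ 0 := by
  haveI : CompactSpace (↥(UnitaryGroup.adelic ↥(maximalRealSubfield L) L (IsCMField.complexConj L) 1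
      (Matrix.diagonal 1)) ⧸ (UnitaryGroup.toAdelic ↥(maximalRealSubfield L) L (IsCMField.complexConj L) 1
      (Matrix.diagonal 1)).range) := compactSpace_quotient_range_toAdelic_line L 1 (complexConj_one_vec L) (one_vec_ne_zero L)
  exact cmThetaKernelDatum_line_exists_character_thetaLift_gaussSB_haar_ne_zero_fun L e 1 (complexConj_one_vec L)
    (one_vec_ne_zero L) 1 (complexConj_one_vec L) (one_vec_ne_zero L) ι
    (GRConstruction.compatibleSplitting_cmSplittingDatum L e 1 (complexConj_one_vec L) (one_vec_ne_zero L) 1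
      (complexConj_one_vec L) (one_vec_ne_zero L))
    ⟨0, Or.inl fun i hi => absurd (Subsingleton.elim i 0) hi⟩ (fun τ _ => Or.inl (re_apply_one_vec_pos L τ))

/-- **FOR EVERY CM FIELD `L`, UNCONDITIONALLY: the opposite theta correspondence `C([U(⟨1⟩)]) → C([U(⟨1⟩)])`
(FGKP (12.38)) at the Gaussian level is non-zero** — `Θᵗ_{Φ_G}(F) ≠ 0` for some continuous `F`, for every finite Borel
measure `ν` on `[U(⟨1⟩)]` charging open sets. [cite: GelbartRogawski1991, §3.1 Prop. 3.1.1 p. 455 L1–2; FleigEtAl2018,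
§12.3 Definition 12.5 (12.38), p. 296; DeitmarEchterhoff2014, Prop. 3.5.2] -/
theorem gru_U1U1_exists_thetaLiftT_gaussSB_ne_zero (e : Fin 1 × Fin 1 ≃ Fin 1) (ι : L →+* ℂ)
    [MeasurableSpace (↥(UnitaryGroup.adelic ↥(maximalRealSubfield L) L (IsCMField.complexConj L) 1 (Matrix.diagonal 1)) ⧸
      (UnitaryGroup.toAdelic ↥(maximalRealSubfield L) L (IsCMField.complexConj L) 1 (Matrix.diagonal 1)).range)]
    [BorelSpace (↥(UnitaryGroup.adelic ↥(maximalRealSubfield L) L (IsCMField.complexConj L) 1 (Matrix.diagonal 1)) ⧸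
      (UnitaryGroup.toAdelic ↥(maximalRealSubfield L) L (IsCMField.complexConj L) 1 (Matrix.diagonal 1)).range)]
    (ν : Measure (↥(UnitaryGroup.adelic ↥(maximalRealSubfield L) L (IsCMField.complexConj L) 1 (Matrix.diagonal 1)) ⧸
      (UnitaryGroup.toAdelic ↥(maximalRealSubfield L) L (IsCMField.complexConj L) 1 (Matrix.diagonal 1)).range))
    [IsFiniteMeasure ν] [ν.IsOpenPosMeasure] :
    haveI := normal_range_toAdelic_line L 1
    haveI : CompactSpace (↥(UnitaryGroup.adelic ↥(maximalRealSubfield L) L (IsCMField.complexConj L) 1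
        (Matrix.diagonal 1)) ⧸ (UnitaryGroup.toAdelic ↥(maximalRealSubfield L) L (IsCMField.complexConj L) 1
        (Matrix.diagonal 1)).range) := compactSpace_quotient_range_toAdelic_line L 1 (complexConj_one_vec L) (one_vec_ne_zero L)
    ∃ F : C(↥(UnitaryGroup.adelic ↥(maximalRealSubfield L) L (IsCMField.complexConj L) 1 (Matrix.diagonal 1)) ⧸
        (UnitaryGroup.toAdelic ↥(maximalRealSubfield L) L (IsCMField.complexConj L) 1 (Matrix.diagonal 1)).range, ℂ),
      (cmThetaKernelDatum L e 1 (complexConj_one_vec L) (one_vec_ne_zero L) 1 (complexConj_one_vec L) (one_vec_ne_zero L)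
          (GRConstruction.compatibleSplitting_cmSplittingDatum L e 1 (complexConj_one_vec L) (one_vec_ne_zero L) 1
            (complexConj_one_vec L) (one_vec_ne_zero L))
          (hasThetaMajorants_cmPairSplitting_of_signs_one L e 1 (complexConj_one_vec L) (one_vec_ne_zero L) 1
            (complexConj_one_vec L) (one_vec_ne_zero L) ι
            (GRConstruction.compatibleSplitting_cmSplittingDatum L e 1 (complexConj_one_vec L) (one_vec_ne_zero L) 1
              (complexConj_one_vec L) (one_vec_ne_zero L))
            ⟨0, Or.inl fun i hi => absurd (Subsingleton.elim i 0) hi⟩ (fun τ _ => Or.inl (re_apply_one_vec_pos L τ)))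
          Set.univ (fun _ _ _ => Set.mem_univ _)).thetaLiftT ν (gaussSB ↥(maximalRealSubfield L) 1) F ≠ 0 := by
  haveI : CompactSpace (↥(UnitaryGroup.adelic ↥(maximalRealSubfield L) L (IsCMField.complexConj L) 1
      (Matrix.diagonal 1)) ⧸ (UnitaryGroup.toAdelic ↥(maximalRealSubfield L) L (IsCMField.complexConj L) 1
      (Matrix.diagonal 1)).range) := compactSpace_quotient_range_toAdelic_line L 1 (complexConj_one_vec L) (one_vec_ne_zero L)
  exact cmThetaKernelDatum_line_exists_thetaLiftT_gaussSB_ne_zero L e 1 (complexConj_one_vec L) (one_vec_ne_zero L) 1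
    (complexConj_one_vec L) (one_vec_ne_zero L)
    (GRConstruction.compatibleSplitting_cmSplittingDatum L e 1 (complexConj_one_vec L) (one_vec_ne_zero L) 1
      (complexConj_one_vec L) (one_vec_ne_zero L))
    ι (fun τ _ => Or.inl (re_apply_one_vec_pos L τ)) ⟨0, Or.inl fun i hi => absurd (Subsingleton.elim i 0) hi⟩ ν

/-- **FOR EVERY CM FIELD `L`, UNCONDITIONALLY: a THETA-RELATED PAIR of automorphic characters of `[U(⟨1⟩)]`.**  For
every complex embedding `ι`, every re-indexing `e` and every finite Borel measure `ν` on `[U(⟨1⟩)]` charging open sets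
there are continuous unitary characters `χ`, `ψ` of the compact abelian group `[U(⟨1⟩)]` with
`∫ Θ^{Haar}_{Φ_G}(χ)(ξ) ψ(ξ) dν(ξ) ≠ 0` — the `ψ̄`-th Fourier coefficient of the Haar theta lift of `χ` at the Gaussian
level is non-zero: the character-to-character theta correspondence between the two `U(1)`'s has a non-zero matrix
coefficient, with NO hypothesis but the field ([GelbartRogawski1991, Prop. 3.1.1] supplied by
`GRConstruction.compatibleSplitting_cmSplittingDatum`; the character `χ` of
`gru_U1U1_exists_character_thetaLift_gaussSB_haar_ne_zero`, then Pontryagin–van Kampen on the first member,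
`exists_integral_mul_character_ne_zero`). [cite: GelbartRogawski1991, §3.1 Prop. 3.1.1 p. 455 L1–2; GelbartRogawski1991,
§3.2 p. 457; FleigEtAl2018, §12.3 Definition 12.5 (12.37), p. 296; DeitmarEchterhoff2014, Prop. 3.5.2] -/
theorem gru_U1U1_exists_character_pair_integral_thetaLift_gaussSB_ne_zero (ι : L →+* ℂ) (e : Fin 1 × Fin 1 ≃ Fin 1) :
    haveI := normal_range_toAdelic_line L 1
    letI : MeasurableSpace (↥(UnitaryGroup.adelic ↥(maximalRealSubfield L) L (IsCMField.complexConj L) 1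
        (Matrix.diagonal 1)) ⧸ (UnitaryGroup.toAdelic ↥(maximalRealSubfield L) L (IsCMField.complexConj L) 1
        (Matrix.diagonal 1)).range) := borel _
    haveI : BorelSpace (↥(UnitaryGroup.adelic ↥(maximalRealSubfield L) L (IsCMField.complexConj L) 1
        (Matrix.diagonal 1)) ⧸ (UnitaryGroup.toAdelic ↥(maximalRealSubfield L) L (IsCMField.complexConj L) 1
        (Matrix.diagonal 1)).range) := ⟨rfl⟩
    haveI : CompactSpace (↥(UnitaryGroup.adelic ↥(maximalRealSubfield L) L (IsCMField.complexConj L) 1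
        (Matrix.diagonal 1)) ⧸ (UnitaryGroup.toAdelic ↥(maximalRealSubfield L) L (IsCMField.complexConj L) 1
        (Matrix.diagonal 1)).range) := compactSpace_quotient_range_toAdelic_line L 1 (complexConj_one_vec L) (one_vec_ne_zero L)
    ∀ (ν : Measure (↥(UnitaryGroup.adelic ↥(maximalRealSubfield L) L (IsCMField.complexConj L) 1 (Matrix.diagonal 1)) ⧸
        (UnitaryGroup.toAdelic ↥(maximalRealSubfield L) L (IsCMField.complexConj L) 1 (Matrix.diagonal 1)).range))
      [IsFiniteMeasure ν] [ν.IsOpenPosMeasure],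
      ∃ χ ψ : PontryaginDual (↥(UnitaryGroup.adelic ↥(maximalRealSubfield L) L (IsCMField.complexConj L) 1
          (Matrix.diagonal 1)) ⧸ (UnitaryGroup.toAdelic ↥(maximalRealSubfield L) L (IsCMField.complexConj L) 1
          (Matrix.diagonal 1)).range),
        ∫ ξ, (cmThetaKernelDatum L e 1 (complexConj_one_vec L) (one_vec_ne_zero L) 1 (complexConj_one_vec L)
            (one_vec_ne_zero L)
            (GRConstruction.compatibleSplitting_cmSplittingDatum L e 1 (complexConj_one_vec L) (one_vec_ne_zero L) 1
              (complexConj_one_vec L) (one_vec_ne_zero L))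
            (hasThetaMajorants_cmPairSplitting_of_signs_one L e 1 (complexConj_one_vec L) (one_vec_ne_zero L) 1
              (complexConj_one_vec L) (one_vec_ne_zero L) ι
              (GRConstruction.compatibleSplitting_cmSplittingDatum L e 1 (complexConj_one_vec L) (one_vec_ne_zero L) 1
                (complexConj_one_vec L) (one_vec_ne_zero L))
              ⟨0, Or.inl fun i hi => absurd (Subsingleton.elim i 0) hi⟩ (fun τ _ => Or.inl (re_apply_one_vec_pos L τ)))
            Set.univ (fun _ _ _ => Set.mem_univ _)).thetaLift Measure.haar (gaussSB ↥(maximalRealSubfield L) 1)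
            (charCM χ) ξ * charCM ψ ξ ∂ν ≠ 0 := by
  haveI := normal_range_toAdelic_line L 1
  letI : MeasurableSpace (↥(UnitaryGroup.adelic ↥(maximalRealSubfield L) L (IsCMField.complexConj L) 1
      (Matrix.diagonal 1)) ⧸ (UnitaryGroup.toAdelic ↥(maximalRealSubfield L) L (IsCMField.complexConj L) 1
      (Matrix.diagonal 1)).range) := borel _
  haveI : BorelSpace (↥(UnitaryGroup.adelic ↥(maximalRealSubfield L) L (IsCMField.complexConj L) 1
      (Matrix.diagonal 1)) ⧸ (UnitaryGroup.toAdelic ↥(maximalRealSubfield L) L (IsCMField.complexConj L) 1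
      (Matrix.diagonal 1)).range) := ⟨rfl⟩
  haveI : CompactSpace (↥(UnitaryGroup.adelic ↥(maximalRealSubfield L) L (IsCMField.complexConj L) 1
      (Matrix.diagonal 1)) ⧸ (UnitaryGroup.toAdelic ↥(maximalRealSubfield L) L (IsCMField.complexConj L) 1
      (Matrix.diagonal 1)).range) := compactSpace_quotient_range_toAdelic_line L 1 (complexConj_one_vec L) (one_vec_ne_zero L)
  intro ν _ _
  letI : CommGroup ↥(UnitaryGroup.adelic ↥(maximalRealSubfield L) L (IsCMField.complexConj L) 1 (Matrix.diagonal 1)) :=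
    { (inferInstance : Group ↥(UnitaryGroup.adelic ↥(maximalRealSubfield L) L (IsCMField.complexConj L) 1
        (Matrix.diagonal 1))) with
      mul_comm := adelic_line_mul_comm L 1 }
  haveI : T2Space (↥(UnitaryGroup.adelic ↥(maximalRealSubfield L) L (IsCMField.complexConj L) 1 (Matrix.diagonal 1)) ⧸
      (UnitaryGroup.toAdelic ↥(maximalRealSubfield L) L (IsCMField.complexConj L) 1 (Matrix.diagonal 1)).range) :=
    t2Space_quotient_range_toAdelic L 1 (Matrix.diagonal 1)
  obtain ⟨χ, hne⟩ := gru_U1U1_exists_character_thetaLift_gaussSB_haar_ne_zero L e ι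
  -- `charCM ψ ξ = ↑(ψ ξ)` definitionally; no `simp` through the theta-kernel datum
  obtain ⟨ψ, hψ⟩ := exists_integral_mul_character_ne_zero ν _ hne
  exact ⟨χ, ψ, hψ⟩

end U1U1

/-! ## §3. The sextic Picard datum `(U(H₇), U(⟨1⟩))` over `ℚ(ζ₇)` — binder `e` only -/

section Sextic

open Literature.NumberTheory.Automorphic.PicardSextic (E₇ d₇ H₇_anisotropic)

/-- **THE SEXTIC PICARD DATUM, UNCONDITIONALLY** (`E₇ = ℚ(ζ₇)`, `H₇ = diag(1, 1, -(ζ₇ + ζ₇⁻¹))` of signature `(2,1)`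
at the inclusion and definite elsewhere, `[U(H₇)]` compact by `PicardSextic.H₇_anisotropic`): some continuous unitary
character `χ` of the compact abelian group `[U(⟨1⟩)]` has a theta lift `Θ_{Φ_G}(χ)` (Haar measure) which is a NON-ZERO
element of `C([U(H₇)], ℂ)` — binder `e` only; [GelbartRogawski1991, Prop. 3.1.1] supplied by
`GRConstruction.compatibleSplitting_cmSplittingDatum`. [cite: GelbartRogawski1991, §3.1 Prop. 3.1.1 p. 455 L1–2;
GelbartRogawski1991, §3.2 p. 457; FleigEtAl2018, §12.3 Definition 12.5 (12.37), p. 296; DeitmarEchterhoff2014,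
Prop. 3.5.2; BergeronMillsonMoeglin2016Balls, Introduction §1.1] -/
theorem gru_sexticPicard_exists_character_thetaLift_gaussSB_haar_ne_zero (e : Fin 3 × Fin 1 ≃ Fin 3) :
    haveI := normal_range_toAdelic_line ↥E₇ 1
    letI : MeasurableSpace (↥(UnitaryGroup.adelic ↥(maximalRealSubfield ↥E₇) ↥E₇ (IsCMField.complexConj ↥E₇) 1 (Matrix.diagonal 1)) ⧸
        (UnitaryGroup.toAdelic ↥(maximalRealSubfield ↥E₇) ↥E₇ (IsCMField.complexConj ↥E₇) 1 (Matrix.diagonal 1)).range) := borel _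
    haveI : BorelSpace (↥(UnitaryGroup.adelic ↥(maximalRealSubfield ↥E₇) ↥E₇ (IsCMField.complexConj ↥E₇) 1 (Matrix.diagonal 1)) ⧸
        (UnitaryGroup.toAdelic ↥(maximalRealSubfield ↥E₇) ↥E₇ (IsCMField.complexConj ↥E₇) 1 (Matrix.diagonal 1)).range) := ⟨rfl⟩
    haveI : CompactSpace (↥(UnitaryGroup.adelic ↥(maximalRealSubfield ↥E₇) ↥E₇ (IsCMField.complexConj ↥E₇) 3 (Matrix.diagonal d₇)) ⧸
        (UnitaryGroup.toAdelic ↥(maximalRealSubfield ↥E₇) ↥E₇ (IsCMField.complexConj ↥E₇) 3 (Matrix.diagonal d₇)).range) :=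
      compactSpace_quotient_range_toAdelic_of_anisotropic ↥E₇ 3 (Matrix.diagonal d₇) H₇_anisotropic
    ∃ χ : PontryaginDual (↥(UnitaryGroup.adelic ↥(maximalRealSubfield ↥E₇) ↥E₇ (IsCMField.complexConj ↥E₇) 1 (Matrix.diagonal 1)) ⧸
        (UnitaryGroup.toAdelic ↥(maximalRealSubfield ↥E₇) ↥E₇ (IsCMField.complexConj ↥E₇) 1 (Matrix.diagonal 1)).range),
      (cmThetaKernelDatum ↥E₇ e d₇ complexConj_d₇ d₇_ne_zero 1 (complexConj_one_vec ↥E₇) (one_vec_ne_zero ↥E₇)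
          (GRConstruction.compatibleSplitting_cmSplittingDatum ↥E₇ e d₇ complexConj_d₇ d₇_ne_zero 1
            (complexConj_one_vec ↥E₇) (one_vec_ne_zero ↥E₇))
          (hasThetaMajorants_cmPairSplitting_of_signs_one ↥E₇ e d₇ complexConj_d₇ d₇_ne_zero 1 (complexConj_one_vec ↥E₇)
            (one_vec_ne_zero ↥E₇) E₇.subtype
            (GRConstruction.compatibleSplitting_cmSplittingDatum ↥E₇ e d₇ complexConj_d₇ d₇_ne_zero 1
              (complexConj_one_vec ↥E₇) (one_vec_ne_zero ↥E₇))
            ⟨Fin.last 2, Or.inl fun _ hi => re_apply_d₇_pos_of_ne E₇.subtype hi⟩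
            (fun τ hτ => Or.inl (re_apply_d₇_pos τ hτ)))
          Set.univ (fun _ _ _ => Set.mem_univ _)).thetaLift Measure.haar (gaussSB ↥(maximalRealSubfield ↥E₇) 3) (charCM χ) ≠ 0 :=
  haveI : CompactSpace (↥(UnitaryGroup.adelic ↥(maximalRealSubfield ↥E₇) ↥E₇ (IsCMField.complexConj ↥E₇) 3 (Matrix.diagonal d₇)) ⧸
      (UnitaryGroup.toAdelic ↥(maximalRealSubfield ↥E₇) ↥E₇ (IsCMField.complexConj ↥E₇) 3 (Matrix.diagonal d₇)).range) :=
    compactSpace_quotient_range_toAdelic_of_anisotropic ↥E₇ 3 (Matrix.diagonal d₇) H₇_anisotropic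
  cmThetaKernelDatum_line_exists_character_thetaLift_gaussSB_haar_ne_zero_fun ↥E₇ e d₇ complexConj_d₇ d₇_ne_zero 1
    (complexConj_one_vec ↥E₇) (one_vec_ne_zero ↥E₇) E₇.subtype
    (GRConstruction.compatibleSplitting_cmSplittingDatum ↥E₇ e d₇ complexConj_d₇ d₇_ne_zero 1
      (complexConj_one_vec ↥E₇) (one_vec_ne_zero ↥E₇))
    ⟨Fin.last 2, Or.inl fun _ hi => re_apply_d₇_pos_of_ne E₇.subtype hi⟩ (fun τ hτ => Or.inl (re_apply_d₇_pos τ hτ))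

end Sextic

/-! ### Build-lane note
As in the lineage (ops-buildfix G11b-3): the public theorems whose statements unfold to the theta-kernel data are tagged
`[implicit_reducible]` only to keep them out of the library-suggestion index computed at `.olean` export. -/
set_option allowUnsafeReducibility true in
attribute [implicit_reducible]
  gru_line_exists_character_thetaLift_gaussSB_haar_ne_zero
  gru_line_exists_thetaLiftT_gaussSB_ne_zero
  gru_signs_exists_smulInvariantMeasure_thetaLift_gaussSB_ne_zero
  gru_U1U1_exists_character_thetaLift_gaussSB_haar_ne_zero
  gru_U1U1_exists_thetaLiftT_gaussSB_ne_zero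
  gru_U1U1_exists_character_pair_integral_thetaLift_gaussSB_ne_zero
  gru_sexticPicard_exists_character_thetaLift_gaussSB_haar_ne_zero

end UnitaryDualPair

end Literature.NumberTheory.GelbartRogawski1991

end
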